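import Literature.Geometry.Lorentzian.MinimalGraphMaximumPrinciple
import Literature.Topology.FourManifolds.InverseFunctionTheorem
import Literature.Topology.FourManifolds.KnotFraming
import HarnessLib

/-!
# Touching embedded surfaces are locally graphs: proof of `touchingSurface_locallyGraph`
(family `gr`, in support of **gr.S09**; namespace `Literature.Geometry.Lorentzian`)

`MinimalGraphMaximumPrinciple.lean` vendors the differential-topological ingredient of the
barrier principle for minimal surfaces as the named fact
`Literature.Geometry.Lorentzian.touchingSurface_locallyGraph`: a smoothly embedded surface
`f : S → X` of a `3`-manifold which, on an open `W ⊆ S`, lies in the closed lower half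
`{x³ ≤ 0}` of a straightened chart `(x', x³) = T ∘ ψ` inside an open `O ⊆ ψ.source`, and touches
the slice `{x³ = 0}` at `f w₀`, is — inside a small coordinate cylinder `V × (-r, r)` around
`f w₀` — exactly the graph `x³ = u(x')` of a smooth `u` over a preconnected base `V`, with
`|u| < r`, `u(x'(f w₀)) = 0`, and the graph contained in `f(W)`. This file **proves** it
(`touchingSurface_locallyGraph_holds`), discharging the fact.

## Proof

As printed in the docstring of the fact (first-derivative test + inverse function theorem,
Lee 2013, Thm. 4.5):

* the base and height maps `g₁ = x' ∘ ψ ∘ f : S → ℝ²`, `g₂ = x³ ∘ ψ ∘ f : S → ℝ` are `C^∞` on `W`;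
  the differential of `g = (g₁, g₂) = T ∘ ψ ∘ f` at `w₀` is injective (chain rule: `T` is a linear
  isomorphism, `ψ` a chart of the maximal atlas, `f` an immersion —
  `Literature.Topology.FourManifolds.Manifold.IsImmersionAt.mfderiv_injective`);
* `g₂ ≤ 0 = g₂ w₀` on the neighbourhood `W` of `w₀`, so `d(g₂)_{w₀} = 0`
  (`IsLocalMax.fderiv_eq_zero` read in the chart at `w₀`); hence `d(g₁)_{w₀}` is injective,
  so invertible (`ℝ² → ℝ²`);
* the inverse function theorem on manifolds
  (`Literature.Topology.FourManifolds.isLocalDiffeomorphAt_of_mfderiv`, Lee's Thm. 4.5) makes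
  `g₁` a local diffeomorphism `Φ` at `w₀`; put `W₀ = Φ.source ∩ W` and
  `u = g₂ ∘ Φ⁻¹`, smooth on the open `V₀ = Φ(W₀)`;
* `f` is a topological embedding, so `W₀ = f ⁻¹' G` for an open `G ⊆ X`; the open set
  `T(ψ(G ∩ O ∩ ψ.source)) ∋ (x'(f w₀), 0)` contains a product of balls
  `B(x'(f w₀), ε) × (-ε, ε)`; shrinking the base to a ball `V = B(x'(f w₀), ρ) ⊆ V₀` on which
  `|u| < ε` (continuity of `u`, `u(x'(f w₀)) = 0`) gives the cylinder `V × (-ε, ε)`: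
  it lies in `ψ.target`, its preimage `C` lies in `G ∩ O`, and `range f ∩ C` is the graph of `u`
  over `V` (a point `f w ∈ C` has `w ∈ W₀`, so `x³(f w) = u(x'(f w))`; a graph point `(y, u y)`
  is `T (ψ (f (Φ⁻¹ y)))` with `f (Φ⁻¹ y) ∈ O ⊆ ψ.source`, and `ψ` is injective on its source).

## References

* J. M. Lee, *Introduction to Smooth Manifolds*, 2nd ed., GTM 218, Springer 2013, Thm. 4.5
  (Inverse Function Theorem for Manifolds), p. 79; Prop. 4.1; Thm. 5.8 and Prop. 5.2.

## Design

The product `ℝ² × ℝ` is used only as a normed space (model `𝓘(ℝ, ℝ² × ℝ)`), never as a product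
manifold, to stay clear of the two charted-space structures on a product of model spaces; the
components are extracted with `hasFDerivAt_fst/snd`. No definitions and no named facts are
introduced here.
-/

noncomputable section

open Bundle Set Manifold Filter Function Metric
open scoped ContDiff Topology Manifold

namespace Literature.Geometry.Lorentzian

/-- **A one-sided touching surface is locally a graph**: discharge of the named fact
`touchingSurface_locallyGraph`. A smoothly embedded surface `f : S → X` in a `3`-manifold with
`f(W) ⊆ {x ∈ O | x³ ≤ 0}` (`W ⊆ S` open, `O ⊆ ψ.source` open, `(x', x³) = T ∘ ψ` for a chart `ψ`
of the maximal atlas and a linear isomorphism `T : ℝ³ ≃ ℝ² × ℝ`) and `x³(f w₀) = 0` for some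
`w₀ ∈ W` is, inside a coordinate cylinder `V × (-r, r) ⊆ ψ.target` over an open preconnected
`V ∋ x'(f w₀)` whose preimage `C` lies in `O`, exactly the graph `{x ∈ C | x³ = u(x')}` of a
function `u` smooth on `V` with values in `(-r, r)` and `u(x'(f w₀)) = 0`, and
`range f ∩ C ⊆ f(W)`. Proof: `x³ ∘ ψ ∘ f` has a local maximum at `w₀`, so its differential
vanishes and `d(x' ∘ ψ ∘ f)_{w₀}` is injective, hence invertible; by the inverse function theorem
for manifolds `x' ∘ ψ ∘ f` is a local diffeomorphism at `w₀`, `u = x³ ∘ ψ ∘ f ∘ (x' ∘ ψ ∘ f)⁻¹`,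
and a small cylinder inside an open `G ∩ O` with `f ⁻¹' G = W₀` (topological embedding) does it.
[cite: LeeSmoothManifolds2013, Thm. 4.5 (inverse function theorem for manifolds)] -/
theorem touchingSurface_locallyGraph_holds : touchingSurface_locallyGraph := by
  intro X _ _ _ S _ _ _ f ψ T O W w₀ hf hψ hO hOψ hW hw₀ hWle h0
  -- Step 0: bookkeeping
  have hfc : ContMDiff (𝓡 2) (𝓡 3) ∞ f := hf.contMDiff
  have hWO : ∀ w ∈ W, f w ∈ O := fun w hw ↦ (hWle (mem_image_of_mem f hw)).1
  have hWsrc : ∀ w ∈ W, f w ∈ ψ.source := fun w hw ↦ hOψ (hWO w hw)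
  have hWle' : ∀ w ∈ W, (T (ψ (f w))).2 ≤ 0 := fun w hw ↦ (hWle (mem_image_of_mem f hw)).2
  have hfw₀ : f w₀ ∈ ψ.source := hWsrc w₀ hw₀
  -- the surface read through the straightened chart: `g = (g₁, g₂) = T ∘ ψ ∘ f`
  set g : S → EuclideanSpace ℝ (Fin 2) × ℝ := fun w ↦ T (ψ (f w)) with hg
  set g₁ : S → EuclideanSpace ℝ (Fin 2) := fun w ↦ (T (ψ (f w))).1 with hg₁
  set g₂ : S → ℝ := fun w ↦ (T (ψ (f w))).2 with hg₂
  -- Step 1: smoothness on `W` (note `𝓡 2 = 𝓘(ℝ, ℝ²)`)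
  have hψc : ContMDiffOn (𝓡 3) (𝓡 3) ∞ ψ ψ.source := contMDiffOn_of_mem_maximalAtlas hψ
  have hTc : ContMDiff 𝓘(ℝ, E3) 𝓘(ℝ, EuclideanSpace ℝ (Fin 2) × ℝ) ∞ T := T.contDiff.contMDiff
  have hgW : ContMDiffOn (𝓡 2) 𝓘(ℝ, EuclideanSpace ℝ (Fin 2) × ℝ) ∞ g W :=
    hTc.comp_contMDiffOn (hψc.comp hfc.contMDiffOn fun w hw ↦ hWsrc w hw)
  have hg₁W : ContMDiffOn (𝓡 2) (𝓡 2) ∞ g₁ W := contDiff_fst.contMDiff.comp_contMDiffOn hgW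
  have hg₂W : ContMDiffOn (𝓡 2) 𝓘(ℝ, ℝ) ∞ g₂ W := contDiff_snd.contMDiff.comp_contMDiffOn hgW
  -- Step 2: the differential of `g` at `w₀` is injective (chain rule; `f` is an immersion)
  have hψmd : ψ.MDifferentiable (𝓡 3) (𝓡 3) :=
    ⟨hψc.mdifferentiableOn (by simp),
      (contMDiffOn_symm_of_mem_maximalAtlas hψ).mdifferentiableOn (by simp)⟩
  have Df : HasMFDerivAt (𝓡 2) (𝓡 3) f w₀ (mfderiv (𝓡 2) (𝓡 3) f w₀) :=
    (hfc.contMDiffAt.mdifferentiableAt (by simp)).hasMFDerivAt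
  have Dψ : HasMFDerivAt (𝓡 3) (𝓡 3) ψ (f w₀) (mfderiv (𝓡 3) (𝓡 3) ψ (f w₀)) :=
    (hψmd.mdifferentiableAt hfw₀).hasMFDerivAt
  have DT : HasMFDerivAt 𝓘(ℝ, E3) 𝓘(ℝ, EuclideanSpace ℝ (Fin 2) × ℝ) T (ψ (f w₀))
      (T : E3 →L[ℝ] EuclideanSpace ℝ (Fin 2) × ℝ) :=
    T.hasFDerivAt.hasMFDerivAt
  set A : EuclideanSpace ℝ (Fin 2) →L[ℝ] EuclideanSpace ℝ (Fin 2) × ℝ :=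
    ((T : E3 →L[ℝ] EuclideanSpace ℝ (Fin 2) × ℝ).comp (mfderiv (𝓡 3) (𝓡 3) ψ (f w₀))).comp
      (mfderiv (𝓡 2) (𝓡 3) f w₀) with hA
  have Dg : HasMFDerivAt (𝓡 2) 𝓘(ℝ, EuclideanSpace ℝ (Fin 2) × ℝ) g w₀ A :=
    (DT.comp (f w₀) Dψ).comp w₀ Df
  have hAinj : Injective A := by
    have h1 : Injective (mfderiv (𝓡 2) (𝓡 3) f w₀) :=
      Literature.Topology.FourManifolds.Manifold.IsImmersionAt.mfderiv_injective
        (hf.isImmersion.isImmersionAt w₀) (by simp)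
    have h2 : Injective (mfderiv (𝓡 3) (𝓡 3) ψ (f w₀)) := hψmd.mfderiv_injective hfw₀
    rw [hA, ContinuousLinearMap.coe_comp, ContinuousLinearMap.coe_comp]
    exact (T.injective.comp h2).comp h1
  -- Step 3: `g₂` has a local maximum at `w₀`, so its differential vanishes there
  have hmax : IsLocalMax g₂ w₀ := by
    filter_upwards [hW.mem_nhds hw₀] with w hw
    show (T (ψ (f w))).2 ≤ (T (ψ (f w₀))).2
    rw [h0]
    exact hWle' w hw
  have hg₂md : MDifferentiableAt (𝓡 2) 𝓘(ℝ, ℝ) g₂ w₀ :=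
    (hg₂W.contMDiffAt (hW.mem_nhds hw₀)).mdifferentiableAt (by simp)
  have hD₂ : mfderiv (𝓡 2) 𝓘(ℝ, ℝ) g₂ w₀ = 0 := by
    have hmax' : IsLocalMax (g₂ ∘ (extChartAt (𝓡 2) w₀).symm) (extChartAt (𝓡 2) w₀ w₀) := by
      refine IsLocalMax.comp_continuous ?_ (continuousAt_extChartAt_symm w₀)
      rw [extChartAt_to_inv]
      exact hmax
    have hw : writtenInExtChartAt (𝓡 2) 𝓘(ℝ, ℝ) w₀ g₂ = g₂ ∘ (extChartAt (𝓡 2) w₀).symm := by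
      funext z
      simp only [writtenInExtChartAt, Function.comp_apply, extChartAt_model_space_eq_id,
        PartialEquiv.refl_coe, id]
    rw [hg₂md.mfderiv, hw, ModelWithCorners.range_eq_univ, fderivWithin_univ]
    exact hmax'.fderiv_eq_zero
  -- Step 4: hence the differential `D₁` of `g₁` at `w₀` is injective, so invertible
  have Dfst := (hasFDerivAt_fst (𝕜 := ℝ) (p := g w₀)).hasMFDerivAt
  have Dsnd := (hasFDerivAt_snd (𝕜 := ℝ) (p := g w₀)).hasMFDerivAt
  set D₁ := (ContinuousLinearMap.fst ℝ (EuclideanSpace ℝ (Fin 2)) ℝ).comp A with hD₁def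
  have hD₁ : mfderiv (𝓡 2) (𝓡 2) g₁ w₀ = D₁ := (Dfst.comp w₀ Dg).mfderiv
  have hD₂' : mfderiv (𝓡 2) 𝓘(ℝ, ℝ) g₂ w₀ =
      (ContinuousLinearMap.snd ℝ (EuclideanSpace ℝ (Fin 2)) ℝ).comp A :=
    (Dsnd.comp w₀ Dg).mfderiv
  have hA2 : ∀ v, (A v).2 = 0 := fun v ↦ by
    have h : ((ContinuousLinearMap.snd ℝ (EuclideanSpace ℝ (Fin 2)) ℝ).comp A) v =
        (0 : EuclideanSpace ℝ (Fin 2) →L[ℝ] ℝ) v :=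
      DFunLike.congr_fun (hD₂'.symm.trans hD₂) v
    simpa using h
  have hD₁inj : Injective D₁ := by
    intro v₁ v₂ hv
    apply hAinj
    exact Prod.ext hv (by rw [hA2, hA2])
  have hD₁surj : Surjective D₁ :=
    (LinearMap.injective_iff_surjective (f := D₁.toLinearMap)).1 hD₁inj
  have hker : LinearMap.ker D₁.toLinearMap = ⊥ := LinearMap.ker_eq_bot.2 hD₁inj
  have hrange : LinearMap.range D₁.toLinearMap = ⊤ := LinearMap.range_eq_top.2 hD₁surj
  set L := ContinuousLinearEquiv.ofBijective D₁ hker hrange with hLdef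
  have hL : mfderiv (𝓡 2) (𝓡 2) g₁ w₀ =
      (L : EuclideanSpace ℝ (Fin 2) →L[ℝ] EuclideanSpace ℝ (Fin 2)) :=
    hD₁.trans (ContinuousLinearEquiv.coe_ofBijective D₁ hker hrange).symm
  -- Step 5: the inverse function theorem on manifolds: `g₁` is a local diffeomorphism at `w₀`
  have hloc : IsLocalDiffeomorphAt (𝓡 2) (𝓡 2) ∞ g₁ w₀ :=
    Literature.Topology.FourManifolds.isLocalDiffeomorphAt_of_mfderiv hW hw₀ hg₁W
      (by exact_mod_cast le_top) L hL
  obtain ⟨Φ, hw₀Φ, heqΦ⟩ := hloc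
  set e := Φ.toPartialEquiv with he_def
  have heq : ∀ w ∈ e.source, e w = (T (ψ (f w))).1 := fun w hw ↦ (heqΦ hw).symm
  have hsymm : ContMDiffOn (𝓡 2) (𝓡 2) ∞ e.symm e.target := Φ.contMDiffOn_invFun
  have hopen_s : IsOpen e.source := Φ.open_source
  have hopen_t : IsOpen e.target := Φ.open_target
  -- Step 6: the neighbourhood `W₀`, the open `G` with `f ⁻¹' G = W₀`, the base `V₀`, and `u`
  set W₀ : Set S := e.source ∩ W with hW₀
  have hW₀open : IsOpen W₀ := hopen_s.inter hW
  have hw₀W₀ : w₀ ∈ W₀ := ⟨hw₀Φ, hw₀⟩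
  obtain ⟨G, hGopen, hGpre⟩ := hf.isEmbedding.isInducing.isOpen_iff.1 hW₀open
  have hGW₀ : ∀ w, f w ∈ G ↔ w ∈ W₀ := fun w ↦ by rw [← hGpre]; rfl
  set V₀ := e.target ∩ e.symm ⁻¹' W₀ with hV₀
  have hV₀open : IsOpen V₀ := hsymm.continuousOn.isOpen_inter_preimage hopen_t hW₀open
  set y₀ := (T (ψ (f w₀))).1 with hy₀
  have hew₀ : e w₀ = y₀ := heq w₀ hw₀Φ
  have hy₀t : y₀ ∈ e.target := hew₀ ▸ e.map_source hw₀Φ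
  have hsy₀ : e.symm y₀ = w₀ := by rw [← hew₀, e.left_inv hw₀Φ]
  have hy₀V₀ : y₀ ∈ V₀ := ⟨hy₀t, by rw [mem_preimage, hsy₀]; exact hw₀W₀⟩
  set u := fun y ↦ (T (ψ (f (e.symm y)))).2 with hu
  have huV₀ : ContMDiffOn (𝓡 2) 𝓘(ℝ, ℝ) ∞ u V₀ :=
    hg₂W.comp (hsymm.mono inter_subset_left) fun y hy ↦ hy.2.2
  have hu_smooth : ContDiffOn ℝ ∞ u V₀ := contMDiffOn_iff_contDiffOn.1 huV₀
  have hu₀ : u y₀ = 0 := by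
    show (T (ψ (f (e.symm y₀)))).2 = 0
    rw [hsy₀, h0]
  -- Step 7: a product of balls inside `T (ψ (G ∩ O))`, shrunk so that `|u| < ε` on the base
  have hfw₀O : f w₀ ∈ O := hWO w₀ hw₀
  set K := T.symm ⁻¹' (ψ.target ∩ ψ.symm ⁻¹' (G ∩ O)) with hK
  have hKopen : IsOpen K :=
    (ψ.isOpen_inter_preimage_symm (hGopen.inter hO)).preimage T.symm.continuous
  have hTw₀ : T (ψ (f w₀)) = (y₀, 0) := Prod.ext rfl h0
  have hK₀ : (y₀, (0 : ℝ)) ∈ K := by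
    rw [← hTw₀]
    show T.symm (T (ψ (f w₀))) ∈ ψ.target ∩ ψ.symm ⁻¹' (G ∩ O)
    rw [T.symm_apply_apply]
    refine ⟨ψ.map_source hfw₀, ?_⟩
    rw [mem_preimage, ψ.left_inv hfw₀]
    exact ⟨(hGW₀ w₀).2 hw₀W₀, hfw₀O⟩
  obtain ⟨ε, hε, hεK⟩ := Metric.isOpen_iff.1 hKopen _ hK₀
  rw [← ball_prod_same] at hεK
  have hu_cont : ContinuousAt u y₀ :=
    hu_smooth.continuousOn.continuousAt (hV₀open.mem_nhds hy₀V₀)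
  obtain ⟨δ₁, hδ₁, hδ₁u⟩ := Metric.continuousAt_iff.1 hu_cont ε hε
  obtain ⟨δ₂, hδ₂, hδ₂V₀⟩ := Metric.isOpen_iff.1 hV₀open y₀ hy₀V₀
  set ρ : ℝ := min ε (min δ₁ δ₂) with hρ
  have hρpos : 0 < ρ := lt_min hε (lt_min hδ₁ hδ₂)
  have hρε : ρ ≤ ε := min_le_left _ _
  have hρδ₁ : ρ ≤ δ₁ := (min_le_right _ _).trans (min_le_left _ _)
  have hρδ₂ : ρ ≤ δ₂ := (min_le_right _ _).trans (min_le_right _ _)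
  have hVV₀ : ball y₀ ρ ⊆ V₀ := (ball_subset_ball hρδ₂).trans hδ₂V₀
  have hIoo : ∀ t, t ∈ Ioo (-ε) ε → t ∈ ball (0 : ℝ) ε := fun t ht ↦
    mem_ball_zero_iff.2 (by rw [Real.norm_eq_abs]; exact abs_lt.2 ht)
  have hcyl : ∀ y t, y ∈ ball y₀ ρ → t ∈ Ioo (-ε) ε → (y, t) ∈ K := fun y t hy ht ↦
    hεK (mk_mem_prod (ball_subset_ball hρε hy) (hIoo t ht))
  -- points of the cylinder `C` over `V = ball y₀ ρ` lie in `G ∩ O`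
  have hCGO : ∀ x ∈ ψ.source, T (ψ x) ∈ ball y₀ ρ ×ˢ Ioo (-ε) ε → x ∈ G ∩ O := by
    intro x hx hxC
    have hk : T.symm (T (ψ x)) ∈ ψ.target ∩ ψ.symm ⁻¹' (G ∩ O) :=
      hcyl (T (ψ x)).1 (T (ψ x)).2 hxC.1 hxC.2
    rw [T.symm_apply_apply] at hk
    have hk' := hk.2
    rwa [mem_preimage, ψ.left_inv hx] at hk'
  -- Step 8: conclusion
  refine ⟨ball y₀ ρ, ε, u, isOpen_ball, (convex_ball y₀ ρ).isPreconnected, mem_ball_self hρpos,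
    hε, ?_, ?_, hu_smooth.mono hVV₀, ?_, hu₀, ?_, ?_⟩
  · -- the cylinder lies in `ψ.target`
    rintro _ ⟨⟨y, t⟩, ⟨hy, ht⟩, rfl⟩
    exact (hcyl y t hy ht).1
  · -- its preimage `C` lies in `O`
    rintro x ⟨hx, hxC⟩
    exact (hCGO x hx hxC).2
  · -- `|u| < ε` on the base
    intro y hy
    have hdist : dist (u y) (u y₀) < ε := hδ₁u (lt_of_lt_of_le (mem_ball.1 hy) hρδ₁)
    rw [hu₀, Real.dist_eq, sub_zero] at hdist
    exact abs_lt.1 hdist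
  · -- `range f ∩ C` is the graph of `u`
    ext x
    constructor
    · rintro ⟨⟨w, rfl⟩, hxs, hxC⟩
      obtain ⟨hG, -⟩ := hCGO (f w) hxs hxC
      have hw : w ∈ W₀ := (hGW₀ w).1 hG
      refine ⟨⟨hxs, hxC⟩, ?_⟩
      show (T (ψ (f w))).2 = (T (ψ (f (e.symm (T (ψ (f w))).1)))).2
      rw [← heq w hw.1, e.left_inv hw.1]
    · rintro ⟨⟨hxs, hxC⟩, hxu⟩
      obtain ⟨hyt, hyW₀⟩ := hVV₀ hxC.1
      have hwsrc : f (e.symm (T (ψ x)).1) ∈ ψ.source := hWsrc _ hyW₀.2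
      refine ⟨⟨e.symm (T (ψ x)).1, ψ.injOn hwsrc hxs (T.injective (Prod.ext ?_ ?_))⟩, hxs, hxC⟩
      · rw [← heq _ hyW₀.1, e.right_inv hyt]
      · exact hxu.symm
  · -- `range f ∩ C ⊆ f(W)`
    rintro x ⟨⟨w, rfl⟩, hxs, hxC⟩
    obtain ⟨hG, -⟩ := hCGO (f w) hxs hxC
    exact ⟨w, ((hGW₀ w).1 hG).2, rfl⟩

end Literature.Geometry.Lorentzian

end
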